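import Mathlib.CategoryTheory.Groupoid
import Mathlib.CategoryTheory.Functor.FullyFaithful
import Mathlib.CategoryTheory.NatIso
import Mathlib.CategoryTheory.Whiskering
import Mathlib.Data.Set.Image
import Literature.IUT.LogThetaLattice.PrimeStripFrame
import HarnessLib

/-!
# [IUTchIII] Def 1.1 (iv)–(vi), Prop 1.2 (vi)–(ix), Thm 1.5 (iii)–(v): mono-analytic log-shells and bi-cores

Mochizuki, *Inter-universal Teichmüller Theory III*, kurims manuscript (May 2020), §1
[cite: Mochizuki2012, III Def 1.1 (iv)–(vi) pp.27–28; Prop 1.2 (vi)–(ix) pp.32–34; Thm 1.5 (iii)–(v) pp.48–51]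
(D-0012 claim key, status disputed; typed over interfaces, nothing asserted beyond compositions of
the interface data).

Printed text (abridged; every field below carries its own locator).
* Def 1.1 (iv)–(vi) pp.27–28: at `v ∈ V̲^{non}` "the ind-topological modules with `G_v(†Π_v)`-action
  `I_{†F_v} ⊆ log(†F_v)` may be constructed solely from the collection of data `†F^{⊢×μ}_v`"; write
  `I_{†F^{⊢×μ}_v} ⊆ log(†F^{⊢×μ}_v)`; similarly at `v ∈ V̲^{arc}` (v); (vi) `I_{†F^{⊢×μ}} := {I_{†F^{⊢×μ}_v}}_v ⊆
  log(†F^{⊢×μ}) := {log(†F^{⊢×μ}_v)}_v`, "constructed solely from the `F^{⊢×μ}`-prime-strip `†F^{⊢×μ}`".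
* Prop 1.2 (vi)/(vii) pp.32–33: [AbsTopIII] Prop 5.8 (ii)/(v) "yield a functorial algorithm in the
  category `†D^⊢_v` for constructing" `log(†D^⊢_v) := {†G_v ↷ k^∼(†G_v)}` and "a "mono-analytic log-shell"
  `I_{†D^⊢_v} := I(†G_v) ⊆ k^∼(†G_v)`"; "there is a natural functorial algorithm … in the collection of data
  `†F^{⊢×μ}_v` for constructing an `Ism`-orbit of isomorphisms [resp. a poly-isomorphism]
  `log(†D^⊢_v) ⥲ log(†F^{⊢×μ}_v)` … as well as a functorial algorithm … in … `†F_v` for constructing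
  isomorphisms `log(†D^⊢_v) ⥲ log(†F^{⊢×μ}_v) ⥲ log(†F_v)` … compatible with one another, … the respective
  log-shells, and the respective log-volumes". (viii) p.33: the collections indexed by `v ∈ V̲`:
  `log(†D^⊢) ⥲ log(†F^{⊢×μ}) ⥲ log(†F)`, `I_{†D^⊢} ⥲ I_{†F^{⊢×μ}} ⥲ I_{†F}`. (ix) p.34: for a `D`-prime-strip
  `*D` with `F(*D)` the `F`-prime-strip determined by `Ψ_cns(*D)` [IUTchII, Rmk 4.5.1 (i)], "a functorial
  algorithm in the `D`-prime-strip `*D` for constructing … "coric holomorphic log-shells" `I_{*D} := I_{†F}`"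
  [`†F = F(*D)`] "together with … natural isomorphisms `I_{*D^⊢} ⥲ I_{*D}`".
* Thm 1.5 (iii) pp.48–50: "there exists a functorial algorithm in the `D^⊢`-prime-strip `^{n,m}D^⊢_△` for
  constructing an `F^{⊢×}`-prime-strip `F^{⊢×}_△(^{n,m}D^⊢_△)`" [hence `F^{⊢×μ}_△(^{n,m}D^⊢_△)`]; the
  poly-isomorphisms of (i), (ii) induce poly-isomorphisms `F^{⊢×μ}_△(^{n,m}D^⊢_△) ⥲ F^{⊢×μ}_△(^{n',m'}D^⊢_△)`
  "for arbitrary `n', m' ∈ ℤ`" — "an invariant — which we shall refer to as "bi-coric" — of both the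
  horizontal and the vertical arrows"; "the Kummer isomorphisms … determine Kummer isomorphisms
  `^{n,m}F^{⊢×μ}_△ ⥲ F^{⊢×μ}_△(^{n,m}D^⊢_△)` which are compatible with the poly-isomorphisms of (ii)".
  (iv) p.50: these induce poly-isomorphisms `{I_{^{n,m}D^⊢_△} ⊆ log(^{n,m}D^⊢_△)} ⥲ {I_{^{n',m'}D^⊢_△} ⊆ …}`
  "compatible with the natural poly-isomorphisms" `{I_{D^⊢_△}} ⥲ {I_{F^{⊢×μ}_△(D^⊢_△)}}` of Prop 1.2 (viii).
  (v) pp.50–51: isomorphisms of the data `(D^⊩(^{n,m}D^⊢_△), Prime(−) ⥲ V̲, {ρ_{D^⊩,v}}_v)` for all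
  `n, m, n', m'`, "compatible … with the `ℝ_{>0}`-orbits of the isomorphisms"
  `(^{n,m}C^⊩_△, …) ⥲ (D^⊩(^{n,m}D^⊢_△), …)` of [IUTchII] Cor 4.6 (ii).

Typing. INTERFACE `BiCoricData`: the output category `Sh` of the log-shell algorithms (pairs
`{I_v ⊆ log(−)_v}_{v∈V̲}`; [AbsTopIII] Prop 5.8, owner abc-iut-L4-t3) and the category `RFrob` of data
"(global realified Frobenioid, `Prime ⥲ V̲`, `{ρ_v}`)" ([IUTchII] Cor 4.5 (ii), owner abc-iut-L6-t2), the
functorial algorithms `holShell`, `fxmShell`, `monoShell`, `fxmOfDv`, `fxOfDsucc`, `realified`, `FofD`, the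
single NATURAL isomorphisms the text prints as such (`fxOfDsucc_delta`, `kummer`, `FofD_D`, `fxmOfDv_dv`) and
the printed ORBITS of isomorphisms as object-wise POLY-isomorphisms (`monoFxm` = the `Ism`- or `{±1}`-orbit
from `†F^{⊢×μ}` alone, `monoFxmOfF ⊆ monoFxm` = the `†F`-level isomorphism of (vi)/(vii), `fxmHol`,
`realifiedKummer` = the `ℝ_{>0}`-orbit; reviews of p405513/p406347). Over it everything else is a
DEFINITION by composition of poly-isomorphisms (`monoHolAt`/`monoHolAt'` = Prop 1.2 (viii); `coricHolShell`,
`coricIsoAt` = (ix); `verticalPolyIso`, `horizontalPolyIso`, `biCoricPolyIso` = vertical-then-horizontal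
composite, `monoShellOfDeltaAt`, `shellKummerAt` = Thm 1.5 (iii), (iv)) or a THEOREM
(`verticalPolyIso_subset`: the vertical poly-isomorphism lies inside the horizontal-type one, by
naturality of `F^{⊢×μ}_△(†D_≻) ⥲ F^{⊢×μ}_△(†D^⊢_△)`; `biCoricPolyIso_subset`). The Frobenius-like strip
`^{n,m}F^{⊢×μ}_△` of a Hodge theater enters as the field `fxmDeltaHT` (= `ThetaLinkData.fxmDelta` of
`HodgeTheaterLogLink.lean`, repeated to keep imports at depth 1).
Rmk 1.5.4 (i) p.56 introduces the TERMS "Kummer-detachment indeterminacies" (step (a): Frobenius-like →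
étale-like via Kummer isomorphisms) and "étale-transport indeterminacies" (step (b): transport between
arithmetic holomorphic structures via multiradiality) — typed as `IndeterminacyKind`. Deliberately NOT
typed (expository Remark sub-items, L6 convention C1; Rmk 1.5.1 (ii) is `RemarksArithmetic.lean`):
Rmk 1.5.1 (i), (iii); Rmk 1.5.2 (i)–(iii); Rmk 1.5.3 (i)–(iii) (Fig. 1.4); Rmk 1.5.4 (ii), (iii).
-/

namespace Literature.IUT.LogThetaLattice

open CategoryTheory
open Literature.IUT.HodgeTheaters

universe u

/-- **IUTchIII:Rmk1.5.4(i)** (kurims p.56) "We shall refer to the indeterminacies that arise from (a)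
[passing from Frobenius-like structures to étale-like structures via various Kummer isomorphisms] as
Kummer-detachment indeterminacies and to the indeterminacies that arise from (b) [transporting the
resulting étale-like structures from one arithmetic holomorphic structure to another by means of
various multiradiality properties] as étale-transport indeterminacies." [claim: Mochizuki2012, status: disputed] -/
inductive IndeterminacyKind : Type
  /-- step (a): "Kummer-detachment indeterminacies" -/
  | kummerDetachment
  /-- step (b): "étale-transport indeterminacies" -/
  | etaleTransport
  deriving DecidableEq

/-- **IUTchIII:Prop1.2(viii)** (kurims p.33) INTERFACE for Def 1.1 (iv)–(vi), Prop 1.2 (vi)–(ix), Thm 1.5 (iii)–(v) (see the module docstring;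
owners: abc-iut-L4-t3 for [AbsTopIII] Prop 5.8 / Cor 5.10, abc-iut-L6-t2 for [IUTchII] Cor 4.5, 4.6,
4.10, Rmk 4.5.1; TODO-merge). Poly-isomorphism data are recorded AS poly-isomorphisms (`Ism`-orbits,
`{±1}`-orbits, `ℝ_{>0}`-orbits), never as a chosen natural representative (review of p405513).
[claim: Mochizuki2012, status: disputed] -/
structure BiCoricData (S : StripFrame.{u}) where
  /-- the category of collections `{I_v ⊆ log(−)_v}_{v ∈ V̲}` (ind-topological modules with a log-shell and
  log-volumes, isomorphisms compatible with both) [Prop 1.2 (viii); AbsTopIII Prop 5.8] -/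
  Sh : Type u
  [catSh : Category.{u} Sh]
  /-- `†F ↦ {I_{†F} ⊆ log(†F)}`, the holomorphic log-shells [Def 1.1 (iii) p.27] -/
  holShell : S.F ⥤ Sh
  /-- `†F^{⊢×μ} ↦ {I_{†F^{⊢×μ}} ⊆ log(†F^{⊢×μ})}` "constructed solely from the `F^{⊢×μ}`-prime-strip" [Def 1.1 (vi) p.28] -/
  fxmShell : S.Fxm ⥤ Sh
  /-- `†D^⊢ ↦ {I_{†D^⊢} ⊆ log(†D^⊢)}`, the mono-analytic log-shells [Prop 1.2 (vi), (vii), (viii)] -/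
  monoShell : S.Dv ⥤ Sh
  /-- Prop 1.2 (vi) p.32 / (vii) p.33: "an `Ism`-orbit of isomorphisms" (nonarchimedean `v`), "a
  poly-isomorphism [i.e., an orbit … of `{±1}` …]" (archimedean `v`) `log(†D^⊢) ⥲ log(†F^{⊢×μ})`, one
  poly-isomorphism per `F^{⊢×μ}`-prime-strip -/
  monoFxm : ∀ X : S.Fxm, PolyIso (monoShell.obj (S.FxmToDv.obj X)) (fxmShell.obj X)
  /-- it is nonempty -/
  monoFxm_nonempty : ∀ X : S.Fxm, (monoFxm X).Nonempty
  /-- "functorial algorithm in the collection of data `†F^{⊢×μ}_v`": transport along isomorphisms of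
  `F^{⊢×μ}`-prime-strips preserves the orbit -/
  monoFxm_map : ∀ {X Y : S.Fxm} (f : X ≅ Y) (e : monoShell.obj (S.FxmToDv.obj X) ≅ fxmShell.obj X),
    e ∈ monoFxm X → (monoShell.mapIso (S.FxmToDv.mapIso f)).symm ≪≫ e ≪≫ fxmShell.mapIso f ∈ monoFxm Y
  /-- Prop 1.2 (vi) p.32 / (vii) p.33, second display: "a functorial algorithm in the collection of data `†F_v`
  for constructing ISOMORPHISMS `log(†D^⊢_v) ⥲ log(†F^{⊢×μ}_v)`" (single at `v ∈ V̲^{non}` — `†F_v` carries `Π_v`,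
  which pins the arrow; a `{±1}`-orbit at `v ∈ V̲^{arc}`), one poly-isomorphism per `F`-prime-strip -/
  monoFxmOfF : ∀ X : S.F, PolyIso (monoShell.obj (S.FxmToDv.obj (S.toFxm.obj X))) (fxmShell.obj (S.toFxm.obj X))
  /-- it is nonempty -/
  monoFxmOfF_nonempty : ∀ X : S.F, (monoFxmOfF X).Nonempty
  /-- "compatible with one another [and] the respective log-volumes": the `†F`-level isomorphisms lie in the
  `Ism`-orbit constructed from `†F^{⊢×μ}` alone [Prop 1.2 (vi) p.32] -/
  monoFxmOfF_le : ∀ X : S.F, monoFxmOfF X ⊆ monoFxm (S.toFxm.obj X)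
  /-- Prop 1.2 (vi)/(vii), same display: the [poly-]isomorphisms `log(†F^{⊢×μ}_v) ⥲ log(†F_v)` ("isomorphisms"
  at `v ∈ V̲^{non}`, `{±1}`-poly-isomorphisms at `v ∈ V̲^{arc}`), one per `F`-prime-strip -/
  fxmHol : ∀ X : S.F, PolyIso (fxmShell.obj (S.toFxm.obj X)) (holShell.obj X)
  /-- it is nonempty -/
  fxmHol_nonempty : ∀ X : S.F, (fxmHol X).Nonempty
  /-- `*D ↦ F(*D)`, "the `F`-prime-strip naturally determined by `Ψ_cns(*D)`" [IUTchII, Rmk 4.5.1 (i)] -/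
  FofD : S.D ⥤ S.F
  /-- the `D`-prime-strip of `F(*D)` is `*D` -/
  FofD_D : FofD ⋙ S.toD ≅ 𝟭 S.D
  /-- Thm 1.5 (iii): "a functorial algorithm in the `D^⊢`-prime-strip `^{n,m}D^⊢_△` for constructing"
  `F^{⊢×μ}_△(^{n,m}D^⊢_△)` (via the `F^{⊢×}`-prime-strip `F^{⊢×}_△(−)`) -/
  fxmOfDv : S.Dv ⥤ S.Fxm
  /-- the `D^⊢`-prime-strip of `F^{⊢×μ}_△(D^⊢)` is `D^⊢` -/
  fxmOfDv_dv : fxmOfDv ⋙ S.FxmToDv ≅ 𝟭 S.Dv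
  /-- `†HT^D ↦ †D^⊢_△`, the `D^⊢`-prime-strip of the `F^⊢`-prime-strip `†F^⊢_△` [IUTchII, Cor 4.10 (i)] -/
  dvDelta : S.DHT ⥤ S.Dv
  /-- the label `≻` [IUTchI, Def 6.11 (i)] -/
  succ : S.Label
  /-- Thm 1.5 (iii) p.49: `†D_≻ ↦ F^{⊢×μ}_△(†D_≻)`, "a functorial algorithm in the `D`-prime-strip `^{n,m}D_≻`" -/
  fxOfDsucc : S.D ⥤ S.Fxm
  /-- Thm 1.5 (iii) p.49: the "natural isomorphism `F^{⊢×}_△(^{n,m}D_≻) ⥲ F^{⊢×}_△(^{n,m}D^⊢_△)`", functorial in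
  the `D`-Hodge theater (printed as "a functorial algorithm in the `D`-prime-strip `^{n,m}D_≻`"; since `D^⊢_△` is
  itself determined by `D_≻` [IUTchII, Cor 4.10 (i)], the strip-level form `fxOfDsucc ≅ (D_≻ ↦ D^⊢_△) ⋙ fxmOfDv`
  is the faithful one — to be adopted when the abc-iut-L6-t2 merge fixes `dvDelta`) -/
  fxOfDsucc_delta : S.dstrip succ ⋙ fxOfDsucc ≅ dvDelta ⋙ fxmOfDv
  /-- `†HT ↦ †F^{⊢×μ}_△` (Frobenius-like; = `ThetaLinkData.fxmDelta`) [IUTchII, Cor 4.10 (iv)] -/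
  fxmDeltaHT : S.HT ⥤ S.Fxm
  /-- Thm 1.5 (iii) p.50, final display: the "Kummer isomorphisms `^{n,m}F^{⊢×μ}_△ ⥲ F^{⊢×μ}_△(^{n,m}D^⊢_△)`"
  [from IUTchII, Cor 4.6 (i)], functorial in the Hodge theater -/
  kummer : fxmDeltaHT ≅ (S.htToD ⋙ dvDelta) ⋙ fxmOfDv
  /-- the category of data `(C^⊩, Prime(C^⊩) ⥲ V̲, {ρ_v}_v)` [Thm 1.5 (v) p.51] -/
  RFrob : Type u
  [catRFrob : Category.{u} RFrob]
  /-- `†D^⊢ ↦ (D^⊩(†D^⊢), Prime(D^⊩(†D^⊢)) ⥲ V̲, {ρ_{D^⊩,v}}_v)` [IUTchII, Cor 4.5 (ii)] -/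
  realified : S.Dv ⥤ RFrob
  /-- `†HT ↦ (^{n,m}C^⊩_△, Prime(^{n,m}C^⊩_△) ⥲ V̲, {^{n,m}ρ_{△,v}}_v)` (Frobenius-like) [IUTchII, Cor 4.10 (i)] -/
  realifiedHT : S.HT ⥤ RFrob
  /-- Thm 1.5 (v) p.51: "the `ℝ_{>0}`-orbits of the isomorphisms" `(^{n,m}C^⊩_△, …) ⥲ (D^⊩(^{n,m}D^⊢_△), …)` of
  [IUTchII] Cor 4.6 (ii) — a nonempty poly-isomorphism per Hodge theater -/
  realifiedKummer : ∀ X : S.HT,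
    PolyIso (realifiedHT.obj X) (realified.obj (dvDelta.obj (S.htToD.obj X)))
  /-- the `ℝ_{>0}`-orbit is nonempty -/
  realifiedKummer_nonempty : ∀ X : S.HT, (realifiedKummer X).Nonempty

attribute [instance] BiCoricData.catSh BiCoricData.catRFrob

/-- **IUTchIII:Prop1.2(viii)** (kurims p.33) the frame's identification `D^⊢(F^{⊢×μ}(†F)) = D^⊢(D(†F))`
(`F → F^⊢ → F^{⊢×μ} → D^⊢ = F → D → D^⊢`) at one `F`-prime-strip. [claim: Mochizuki2012, status: disputed] -/
def StripFrame.fxmDvIsoAt (S : StripFrame.{u}) (X : S.F) :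
    S.FxmToDv.obj (S.toFxm.obj X) ≅ S.DToDv.obj (S.toD.obj X) :=
  (S.fxm_comm.app (S.toFv.obj X)).trans (S.toDv_comm.app X)

namespace BiCoricData

variable {S : StripFrame.{u}} (B : BiCoricData S)

/-! ### Prop 1.2 (viii), (ix): composites of poly-isomorphisms -/

/-- **IUTchIII:Prop1.2(viii)** (kurims p.33) the composite [poly-]isomorphism
`log(†D^⊢) ⥲ log(†F^{⊢×μ}) ⥲ log(†F)`, `I_{†D^⊢} ⥲ I_{†F^{⊢×μ}} ⥲ I_{†F}` at the `F`-prime-strip `†F = X`, built from the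
`†F`-LEVEL isomorphisms of Prop 1.2 (vi)/(vii) (`†D^⊢` computed through `†F^{⊢×μ}`). [claim: Mochizuki2012, status: disputed] -/
def monoHolAt (X : S.F) : PolyIso (B.monoShell.obj (S.FxmToDv.obj (S.toFxm.obj X))) (B.holShell.obj X) :=
  (B.monoFxmOfF X).comp (B.fxmHol X)

/-- **IUTchIII:Prop1.2(viii)** (kurims p.33) it is nonempty. [claim: Mochizuki2012, status: disputed] -/
theorem monoHolAt_nonempty (X : S.F) : (B.monoHolAt X).Nonempty := by
  obtain ⟨e, he⟩ := B.monoFxmOfF_nonempty X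
  obtain ⟨f, hf⟩ := B.fxmHol_nonempty X
  exact ⟨e ≪≫ f, e, he, f, hf, rfl⟩

/-- **IUTchIII:Prop1.2(vi)** (kurims p.32) the `†F`-level composite lies inside the `†F^{⊢×μ}`-level (`Ism`-orbit)
composite ("compatible with one another"). [claim: Mochizuki2012, status: disputed] -/
theorem monoHolAt_subset_orbit (X : S.F) : B.monoHolAt X ⊆ (B.monoFxm (S.toFxm.obj X)).comp (B.fxmHol X) := by
  rintro g ⟨e, he, f, hf, rfl⟩
  exact ⟨e, B.monoFxmOfF_le X he, f, hf, rfl⟩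

/-- **IUTchIII:Prop1.2(viii)** (kurims p.33) the same with `†D^⊢` computed as `D^⊢(D(†F))`.
[claim: Mochizuki2012, status: disputed] -/
def monoHolAt' (X : S.F) : PolyIso (B.monoShell.obj (S.DToDv.obj (S.toD.obj X))) (B.holShell.obj X) :=
  (PolyIso.single (B.monoShell.mapIso (S.fxmDvIsoAt X)).symm).comp (B.monoHolAt X)

/-- **IUTchIII:Prop1.2(ix)** (kurims p.34) coric holomorphic log-shells `*D ↦ I_{*D} := I_{F(*D)}`, "a functorial
algorithm in the `D`-prime-strip `*D`". [claim: Mochizuki2012, status: disputed] -/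
def coricHolShell : S.D ⥤ B.Sh := B.FofD ⋙ B.holShell

/-- **IUTchIII:Prop1.2(ix)** (kurims p.34) "natural isomorphisms `I_{*D^⊢} ⥲ I_{*D}`" (`*D^⊢ = D^⊢(*D)`): the
[poly-]isomorphism obtained from the `†F`-level isomorphisms of (vi)/(vii) [(viii)] for `†F = F(*D)` (single at
`v ∈ V̲^{non}`, `{±1}`-orbit at `v ∈ V̲^{arc}`). [claim: Mochizuki2012, status: disputed] -/
def coricIsoAt (D : S.D) : PolyIso (B.monoShell.obj (S.DToDv.obj D)) (B.coricHolShell.obj D) :=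
  (PolyIso.single (B.monoShell.mapIso (S.DToDv.mapIso (B.FofD_D.app D))).symm).comp
    (B.monoHolAt' (B.FofD.obj D))

/-! ### Thm 1.5 (iii): bi-coric `F^{⊢×μ}`-prime-strips -/

/-- **IUTchIII:Thm1.5(iii)** (kurims p.48) `†D^⊢_△` of a `D`-Hodge theater. [claim: Mochizuki2012, status: disputed] -/
abbrev dvDeltaOf (H : S.DHT) : S.Dv := B.dvDelta.obj H

/-- **IUTchIII:Thm1.5(iii)** (kurims p.49) `F^{⊢×μ}_△(†D^⊢_△)`, "regarded, up to isomorphism, as objects constructed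
from `†D^⊢_△`". [claim: Mochizuki2012, status: disputed] -/
abbrev fxmDeltaOf (H : S.DHT) : S.Fxm := B.fxmOfDv.obj (B.dvDelta.obj H)

/-- **IUTchIII:Thm1.5(iii)** (kurims p.49) the natural isomorphism `F^{⊢×μ}_△(†D_≻) ⥲ F^{⊢×μ}_△(†D^⊢_△)` at one
`D`-Hodge theater (component of `fxOfDsucc_delta`, with syntactically plain type). [claim: Mochizuki2012, status: disputed] -/
def deltaIso (H : S.DHT) : B.fxOfDsucc.obj ((S.dstrip B.succ).obj H) ≅ B.fxmDeltaOf H where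
  hom := B.fxOfDsucc_delta.hom.app H
  inv := B.fxOfDsucc_delta.inv.app H
  hom_inv_id := B.fxOfDsucc_delta.hom_inv_id_app H
  inv_hom_id := B.fxOfDsucc_delta.inv_hom_id_app H

/-- **IUTchIII:Thm1.5(iii)** (kurims p.49) naturality of `deltaIso`: conjugating the `D_≻`-induced isomorphism by
the natural isomorphisms gives the `D^⊢_△`-induced one. [claim: Mochizuki2012, status: disputed] -/
theorem mapIso_eq_conj {H H' : S.DHT} (ξ : H ≅ H') :
    (B.deltaIso H).symm ≪≫ B.fxOfDsucc.mapIso ((S.dstrip B.succ).mapIso ξ) ≪≫ B.deltaIso H' =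
      B.fxmOfDv.mapIso (B.dvDelta.mapIso ξ) := by
  ext
  simp only [Iso.trans_hom, Iso.symm_hom, Functor.mapIso_hom]
  exact (Iso.inv_comp_eq (B.deltaIso H)).mpr (B.fxOfDsucc_delta.hom.naturality ξ.hom)

/-- **IUTchIII:Thm1.5(iii)** (kurims p.49) the VERTICAL poly-isomorphism `F^{⊢×μ}_△(^{n,m}D^⊢_△) ⥲ F^{⊢×μ}_△(^{n,m'}D^⊢_△)`:
induced by the FULL poly-isomorphism of `D`-Hodge theaters (Thm 1.5 (i)) through `†D_≻ ↦ F^{⊢×μ}_△(†D_≻)` and the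
natural isomorphisms `deltaIso` ("in general, strictly smaller"). [claim: Mochizuki2012, status: disputed] -/
def verticalPolyIso (H H' : S.DHT) : PolyIso (B.fxmDeltaOf H) (B.fxmDeltaOf H') :=
  ((PolyIso.single (B.deltaIso H).symm).comp
    ((PolyIso.full H H').map (S.dstrip B.succ ⋙ B.fxOfDsucc))).comp (PolyIso.single (B.deltaIso H'))

/-- **IUTchIII:Thm1.5(iii)** (kurims p.49) the HORIZONTAL poly-isomorphism: induced through `F^{⊢×μ}_△(−)` by the
FULL poly-isomorphism `^{n,m}D^⊢_△ ⥲ ^{n+1,m}D^⊢_△` of the horizontal arrow ([IUTchII] Cor 4.10 (iv); "not full").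
[claim: Mochizuki2012, status: disputed] -/
def horizontalPolyIso (H H' : S.DHT) : PolyIso (B.fxmDeltaOf H) (B.fxmDeltaOf H') :=
  (PolyIso.full (B.dvDeltaOf H) (B.dvDeltaOf H')).map B.fxmOfDv

/-- **IUTchIII:Thm1.5(iii)** (kurims p.49) membership in the horizontal poly-isomorphism. [claim: Mochizuki2012, status: disputed] -/
theorem mem_horizontalPolyIso (H H' : S.DHT) (e : B.fxmDeltaOf H ≅ B.fxmDeltaOf H') :
    e ∈ B.horizontalPolyIso H H' ↔ ∃ d : B.dvDeltaOf H ≅ B.dvDeltaOf H', B.fxmOfDv.mapIso d = e := by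
  unfold horizontalPolyIso PolyIso.map PolyIso.full
  rw [Set.image_univ, Set.mem_range]

/-- **IUTchIII:Thm1.5(iii)** (kurims p.49) every vertical constituent IS of horizontal type (naturality of
`F^{⊢×μ}_△(†D_≻) ⥲ F^{⊢×μ}_△(†D^⊢_△)`): the vertical poly-isomorphism is contained in the horizontal-type one —
"strictly smaller" in general. [claim: Mochizuki2012, status: disputed] -/
theorem verticalPolyIso_subset (H H' : S.DHT) : B.verticalPolyIso H H' ⊆ B.horizontalPolyIso H H' := by
  rintro e ⟨f, ⟨a, ha, g, ⟨ξ, -, rfl⟩, rfl⟩, c, hc, rfl⟩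
  rw [PolyIso.mem_single] at ha hc
  subst ha; subst hc
  refine (B.mem_horizontalPolyIso H H' _).mpr ⟨B.dvDelta.mapIso ξ, ?_⟩
  exact (B.mapIso_eq_conj ξ).symm.trans (Iso.trans_assoc _ _ _).symm

/-- **IUTchIII:Thm1.5(iii)** (kurims p.49) "by composing these isomorphisms, one obtains poly-isomorphisms
`F^{⊢×μ}_△(^{n,m}D^⊢_△) ⥲ F^{⊢×μ}_△(^{n',m'}D^⊢_△)` for arbitrary `n', m'`" — vertical step `(n,m) → (n,m')` followed by the
horizontal step `(n,m') → (n',m')`, for a family of Hodge theaters indexed by `ℤ × ℤ`. [claim: Mochizuki2012, status: disputed] -/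
def biCoricPolyIso (H : ℤ × ℤ → S.HT) (p q : ℤ × ℤ) :
    PolyIso (B.fxmDeltaOf (S.htToD.obj (H p))) (B.fxmDeltaOf (S.htToD.obj (H q))) :=
  (B.verticalPolyIso (S.htToD.obj (H p)) (S.htToD.obj (H (p.1, q.2)))).comp
    (B.horizontalPolyIso (S.htToD.obj (H (p.1, q.2))) (S.htToD.obj (H q)))

/-- **IUTchIII:Thm1.5(iii)** (kurims p.50) "an invariant — which we shall refer to as "bi-coric"": every constituent
of the bi-coric poly-isomorphism is induced through `F^{⊢×μ}_△(−)` by an isomorphism of `D^⊢`-prime-strips.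
[claim: Mochizuki2012, status: disputed] -/
theorem biCoricPolyIso_subset (H : ℤ × ℤ → S.HT) (p q : ℤ × ℤ) :
    B.biCoricPolyIso H p q ⊆ B.horizontalPolyIso (S.htToD.obj (H p)) (S.htToD.obj (H q)) := by
  rintro e ⟨f, hf, g, hg, rfl⟩
  obtain ⟨d, rfl⟩ := (B.mem_horizontalPolyIso _ _ f).mp (B.verticalPolyIso_subset _ _ hf)
  obtain ⟨d', rfl⟩ := (B.mem_horizontalPolyIso _ _ g).mp hg
  exact (B.mem_horizontalPolyIso _ _ _).mpr ⟨d ≪≫ d', B.fxmOfDv.mapIso_trans d d'⟩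

/-- **IUTchIII:Thm1.5(iii)** (kurims p.50) the Kummer isomorphism `^{n,m}F^{⊢×μ}_△ ⥲ F^{⊢×μ}_△(^{n,m}D^⊢_△)` at `^{n,m}HT`.
[claim: Mochizuki2012, status: disputed] -/
def kummerAt (X : S.HT) : B.fxmDeltaHT.obj X ≅ B.fxmDeltaOf (S.htToD.obj X) := B.kummer.app X

/-- **IUTchIII:Thm1.5(iii)** (kurims p.50) transport of a Frobenius-like isomorphism along the Kummer isomorphisms
("compatible with the poly-isomorphisms of (ii)"). [claim: Mochizuki2012, status: disputed] -/
def kummerTransport {X Y : S.HT} (e : B.fxmDeltaHT.obj X ≅ B.fxmDeltaHT.obj Y) :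
    B.fxmDeltaOf (S.htToD.obj X) ≅ B.fxmDeltaOf (S.htToD.obj Y) :=
  (B.kummerAt X).symm ≪≫ e ≪≫ B.kummerAt Y

/-! ### Thm 1.5 (iv): bi-coric mono-analytic log-shells -/

/-- **IUTchIII:Thm1.5(iv)** (kurims p.50) the poly-isomorphisms `{I_{D^⊢_△}} ⥲ {I_{D'^⊢_△}}` induced by the
bi-coricity poly-isomorphisms of `D^⊢`-prime-strips. [claim: Mochizuki2012, status: disputed] -/
def biCoricShellPolyIso (H H' : S.DHT) :
    PolyIso (B.monoShell.obj (B.dvDeltaOf H)) (B.monoShell.obj (B.dvDeltaOf H')) :=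
  (PolyIso.full (B.dvDeltaOf H) (B.dvDeltaOf H')).map B.monoShell

/-- **IUTchIII:Thm1.5(iv)** (kurims p.50) `D^⊢(F^{⊢×μ}_△(D^⊢)) ≅ D^⊢` at one object (component of `fxmOfDv_dv`).
[claim: Mochizuki2012, status: disputed] -/
def dvIso (Dm : S.Dv) : S.FxmToDv.obj (B.fxmOfDv.obj Dm) ≅ Dm where
  hom := B.fxmOfDv_dv.hom.app Dm
  inv := B.fxmOfDv_dv.inv.app Dm
  hom_inv_id := B.fxmOfDv_dv.hom_inv_id_app Dm
  inv_hom_id := B.fxmOfDv_dv.inv_hom_id_app Dm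

/-- **IUTchIII:Thm1.5(iv)** (kurims p.50) "the natural poly-isomorphisms `{I_{D^⊢_△}} ⥲ {I_{F^{⊢×μ}_△(D^⊢_△)}}` of
Proposition 1.2, (viii)", at one `D^⊢`-prime-strip: the `Ism`-orbit `monoFxm` at `F^{⊢×μ}_△(D^⊢)` precomposed with
`I_{D^⊢} = I_{D^⊢(F^{⊢×μ}_△(D^⊢))}`. [claim: Mochizuki2012, status: disputed] -/
def monoShellOfDeltaAt (Dm : S.Dv) : PolyIso (B.monoShell.obj Dm) (B.fxmShell.obj (B.fxmOfDv.obj Dm)) :=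
  (PolyIso.single (B.monoShell.mapIso (B.dvIso Dm)).symm).comp (B.monoFxm (B.fxmOfDv.obj Dm))

/-- **IUTchIII:Thm1.5(iv)** (kurims p.50) it is nonempty. [claim: Mochizuki2012, status: disputed] -/
theorem monoShellOfDeltaAt_nonempty (Dm : S.Dv) : (B.monoShellOfDeltaAt Dm).Nonempty := by
  obtain ⟨e, he⟩ := B.monoFxm_nonempty (B.fxmOfDv.obj Dm)
  exact ⟨_, _, rfl, e, he, rfl⟩

/-- **IUTchIII:Thm1.5(iv)** (kurims p.50) last display: `{I_{D^⊢_△}} ⥲ {I_{F^{⊢×μ}_△}} ⥲ …`, the first arrow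
"induced by the Kummer isomorphisms of (iii)" — as a poly-isomorphism at `^{n,m}HT`. [claim: Mochizuki2012, status: disputed] -/
def shellKummerAt (X : S.HT) :
    PolyIso (B.monoShell.obj (B.dvDeltaOf (S.htToD.obj X))) (B.fxmShell.obj (B.fxmDeltaHT.obj X)) :=
  (B.monoShellOfDeltaAt (B.dvDeltaOf (S.htToD.obj X))).comp
    (PolyIso.single (B.fxmShell.mapIso (B.kummerAt X).symm))

/-! ### Thm 1.5 (v): bi-coric mono-analytic global realified Frobenioids -/

/-- **IUTchIII:Thm1.5(v)** (kurims p.50) printed: "an isomorphism of collections of data `(D^⊩(^{n,m}D^⊢_△), …) ⥲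
(D^⊩(^{n',m'}D^⊢_△), …)`" induced by the poly-isomorphisms `^{n,m}D^⊢_△ ⥲ ^{n',m'}D^⊢_△` of (i), (ii) — typed as the
induced POLY-isomorphism (one isomorphism per constituent; weaker packaging than a single isomorphism, says so).
[claim: Mochizuki2012, status: disputed] -/
def biCoricRealifiedPolyIso (H H' : S.DHT) :
    PolyIso (B.realified.obj (B.dvDeltaOf H)) (B.realified.obj (B.dvDeltaOf H')) :=
  (PolyIso.full (B.dvDeltaOf H) (B.dvDeltaOf H')).map B.realified

/-- **IUTchIII:Thm1.5(v)** (kurims p.51) "compatible … with the `ℝ_{>0}`-orbits": transporting the bi-coric realified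
poly-isomorphism along the `ℝ_{>0}`-orbits of Kummer isomorphisms at both ends yields a poly-isomorphism of the
Frobenius-like data `(^{n,m}C^⊩_△, …) ⥲ (^{n',m'}C^⊩_△, …)`. [claim: Mochizuki2012, status: disputed] -/
def realifiedTransport (X Y : S.HT) : PolyIso (B.realifiedHT.obj X) (B.realifiedHT.obj Y) :=
  ((B.realifiedKummer X).comp (B.biCoricRealifiedPolyIso (S.htToD.obj X) (S.htToD.obj Y))).comp
    (B.realifiedKummer Y).symm

/-- **IUTchIII:Thm1.5(v)** (kurims p.51) the transported poly-isomorphism is nonempty whenever the `D^⊢`-prime-strips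
are isomorphic. [claim: Mochizuki2012, status: disputed] -/
theorem realifiedTransport_nonempty (X Y : S.HT)
    (h : Nonempty (B.dvDeltaOf (S.htToD.obj X) ≅ B.dvDeltaOf (S.htToD.obj Y))) :
    (B.realifiedTransport X Y).Nonempty := by
  obtain ⟨a, ha⟩ := B.realifiedKummer_nonempty X
  obtain ⟨c, hc⟩ := B.realifiedKummer_nonempty Y
  exact ⟨(a ≪≫ B.realified.mapIso h.some) ≪≫ c.symm, a ≪≫ B.realified.mapIso h.some,
    ⟨a, ha, _, Set.mem_image_of_mem _ (PolyIso.mem_full h.some), rfl⟩, c.symm, Set.mem_image_of_mem _ hc, rfl⟩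

end BiCoricData

end Literature.IUT.LogThetaLattice
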